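import Literature.Geometry.Riemannian.ChangGurskyYangProofs
import Literature.Geometry.Riemannian.CurvatureNormSq
import Literature.Geometry.Lorentzian.ConformalChangeFour
import HarnessLib

/-!
# Chang–Gursky–Yang 2003: the covariant curvature tensor of a conformal metric on a manifold and
# the frame-wise conformal covariance of the Weyl tensor in dimension four

Companion of `ChangGurskyYangProofs.lean` (a leaf file: its import cone — the chart dictionary of
`CurvatureNormSq.lean` and the conformal calculus of `Lorentzian/ConformalChangeFour.lean` — stays
off the importers of the Proofs file). Everything is PROVED; no definition, no named fact.

Chang–Gursky–Yang 2003 call their Theorem A "a conformally invariant sphere theorem": hypothesis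
(0.3) `∫|W|² dV < 16π²χ` is conformally invariant (p. 106: "our condition has the additional
properties of being sharp and conformally invariant"; p. 111: "the conformal invariance of the
Weyl tensor"). This file proves the curvature identities behind that invariance:

* `chartRep_const_conformal` — the chart components of `g' = φ g` are `(φ ∘ Φ) • (those of g)`;
* `PseudoRiemannianMetric.curvatureForm_conformal` — **the covariant curvature tensor of a
  conformal metric on a manifold** (Besse 1987, Thm. 1.159 (b)): for smooth metrics `g`,
  `g' = φ g` (`φ > 0` smooth) with their Levi-Civita connections, at each point there is a form `B`
  with `Rm'(X,Y,Z,W) = φ (Rm(X,Y,Z,W) − (B ⊙ g)(X,Y,Z,W))` (Kulkarni–Nomizu product in the slot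
  convention of `WeylEnergy.lean`); the coordinate formula
  `MetricCoord.IsMetricOn.apply_riemAt_conformal` (`ConformalChangeFour.lean`, `B = ∇θ − θ⊗θ +
  ½|θ|²g`) read through the chart at the point (`chartRep_riemAt_eq_curvatureForm`,
  `CurvatureNormSq.lean`);
* `sum_kulkarniNomizu_frameDelta_contract`, `weylCombination_kulkarniNomizu_frameDelta` — the
  frame algebra: `Σ_m (h ⊙ δ)_{mabm} = (tr h)δ_{ab} + 2h_{ab}` and the Weyl combination of
  `weylFrame_fin_four` applied to `h ⊙ δ` vanishes identically (Besse 1987, 1.116–1.117: `h ⊙ g`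
  has no Weyl part);
* `PseudoRiemannianMetric.weylFrame_conformal_sq` — **conformal covariance of the Weyl tensor in
  dimension four**: for `g' = ψ² g` and a `g_x`-orthonormal `4`-frame `e`,
  `W_{g'}(e/ψ)_{ijkl} = ψ⁻² W_g(e)_{ijkl}` (`W' = ψ² W` as `(0,4)`-tensors, Besse 1987, 1.159 (c));
  `IsOrthonormalFrame.conformal_sq` (`e/ψ` is `g'`-orthonormal);
* `PseudoRiemannianMetric.normSq_conformal_sq` — "the `η`-term scales in exactly the same way"
  (Chang–Gursky–Yang 2003, §1, p. 116: `|η|²_g = e^{−4w}|η|²₀` for `g = e^{2w}g₀` and a fixed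
  symmetric `2`-tensor `η`): `|T|²_{g'} = a⁻⁴|T|²_g` for `g'_x = a² g_x` and any bilinear form `T`
  (`normSq` of `MetricNormSq.lean`);
* the pointwise law `|W_{ψ²g}|² = ψ⁻⁴|W_g|²` and the conformal invariance of the Weyl energy
  `∫|W|² dV` in dimension four are `PseudoRiemannianMetric.weylNormSq_conformal_sq` and
  `weylEnergy_conformal_sq_four` of `Lorentzian/WeylConformal.lean` (landed concurrently by another
  seat, by naturality of `W` under the inverse chart); the present file supplies the manifold-level
  curvature formula and the frame-wise covariance for general charts `H` (boundaryless model).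

## References

* S.-Y. A. Chang, M. J. Gursky, P. C. Yang, *A conformally invariant sphere theorem in four
  dimensions*, Publ. Math. IHÉS 98 (2003), Thm. A, (0.3), Remark 2, p. 106, p. 111, §1 p. 116.
  [ChangGurskyYang2003]
* A. L. Besse, *Einstein Manifolds* (1987), 1.110, 1.116–1.117, Thm. 1.159 (b), (c). [Besse1987]
* B. O'Neill, *Semi-Riemannian geometry* (1983), Ch. 3, Prop. 3.59 (naturality of curvature).
  [ONeill1983]
-/

noncomputable section

set_option maxSynthPendingDepth 3

open Bundle Finset Module Set Filter Function
open scoped Manifold ContDiff Topology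

namespace Literature.Geometry.Riemannian

/-! ### The covariant curvature tensor of a conformal metric on a manifold -/

section ConformalCurvature

open Literature.Geometry.Lorentzian (PseudoRiemannianMetric)
open Literature.Geometry.Lorentzian.PseudoRiemannianMetric
open Literature.Geometry.Lorentzian

variable {E : Type*} [NormedAddCommGroup E] [NormedSpace ℝ E] [FiniteDimensional ℝ E]
  [CompleteSpace E] {H : Type*} [TopologicalSpace H] {I : ModelWithCorners ℝ E H} [I.Boundaryless]
  {M : Type*} [TopologicalSpace M] [ChartedSpace H M] [IsManifold I ∞ M]

omit [FiniteDimensional ℝ E] [CompleteSpace E] [I.Boundaryless] in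
/-- The chart components of a conformal metric `g' = φ g` at `x₀` are `(φ ∘ Φ) • (components of g)`
as functions on the whole model space (`Φ` the inverse extended chart, junk included). [folklore] -/
theorem chartRep_const_conformal (g g' : PseudoRiemannianMetric I ∞ E (TangentSpace I : M → Type _))
    {φ : M → ℝ} (hgg' : ∀ (x : M) (v w : TangentSpace I x), g'.val x v w = φ x * g.val x v w)
    (x₀ : M) :
    chartRep I (fun _ ↦ g') x₀ 0 =
      fun y ↦ φ ((extChartAt I x₀).symm y) • chartRep I (fun _ ↦ g) x₀ 0 y := by
  funext y
  ext v w
  simp only [chartRep, gramOpFamily, ContinuousLinearMap.bilinearComp_apply, _root_.smul_apply,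
    smul_eq_mul]
  exact hgg' _ _ _

/-- **The covariant curvature tensor of a conformal metric `g' = φ g`** (Besse 1987, Thm. 1.159
(b)): at every point there is a form `B` on `T_xM` (namely `∇θ − θ⊗θ + ½|θ|² g`, `θ = dφ/(2φ)`,
read in a chart; only its existence is recorded) with
`Rm'(X,Y,Z,W) = φ(x) (Rm(X,Y,Z,W) − (B ⊙ g)(X,Y,Z,W))` for all `X, Y, Z, W`, `⊙` the
Kulkarni–Nomizu product in the slot convention of `WeylEnergy.lean`
(`(B ⊙ g)(X,Y,Z,W) = B(X,W)g(Y,Z) + B(Y,Z)g(X,W) − B(X,Z)g(Y,W) − B(Y,W)g(X,Z)`), both metrics with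
their Levi-Civita connections. Proof: read in the chart at `x` (`chartRep_riemAt_eq_curvatureForm`
for `g` and `g'`, whose components differ by the factor `φ ∘ Φ`) and apply the coordinate formula
`MetricCoord.IsMetricOn.apply_riemAt_conformal`. [cite: Besse1987, Thm. 1.159 (b)] -/
theorem _root_.Literature.Geometry.Lorentzian.PseudoRiemannianMetric.curvatureForm_conformal
    (g g' : PseudoRiemannianMetric I ∞ E (TangentSpace I : M → Type _))
    [g.HasLeviCivita] [g'.HasLeviCivita] {φ : M → ℝ} (hφ : ContMDiff I 𝓘(ℝ) ∞ φ)
    (hpos : ∀ x, 0 < φ x)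
    (hgg' : ∀ (x : M) (v w : TangentSpace I x), g'.val x v w = φ x * g.val x v w) (x : M) :
    ∃ B : TangentSpace I x → TangentSpace I x → ℝ,
      ∀ X Y Z W : TangentSpace I x,
        g'.curvatureForm g'.leviCivita x X Y Z W =
          φ x * (g.curvatureForm g.leviCivita x X Y Z W
            - (B X W * g.val x Y Z + B Y Z * g.val x X W - B X Z * g.val x Y W
                - B Y W * g.val x X Z)) := by
  have hLC : g.IsLeviCivita g.leviCivita := g.isLeviCivita_leviCivita_holds
  have hLC' : g'.IsLeviCivita g'.leviCivita := g'.isLeviCivita_leviCivita_holds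
  -- move the point to the form `chartInv I x y₀`
  suffices key : ∀ y : chartTarget I x,
      ∃ B : TangentSpace I (chartInv I x y) → TangentSpace I (chartInv I x y) → ℝ,
        ∀ X Y Z W : TangentSpace I (chartInv I x y),
          g'.curvatureForm g'.leviCivita (chartInv I x y) X Y Z W =
            φ (chartInv I x y) * (g.curvatureForm g.leviCivita (chartInv I x y) X Y Z W
              - (B X W * g.val (chartInv I x y) Y Z + B Y Z * g.val (chartInv I x y) X W
                  - B X Z * g.val (chartInv I x y) Y W - B Y W * g.val (chartInv I x y) X Z)) by
    have hy₀ : extChartAt I x x ∈ (extChartAt I x).target := mem_extChartAt_target x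
    have hΦ : chartInv I x ⟨extChartAt I x x, hy₀⟩ = x := extChartAt_to_inv x
    rw [← hΦ]
    exact key _
  intro y
  -- the chart components of `g` and `g' = φ g`
  set G : E → E →L[ℝ] E →L[ℝ] ℝ := chartRep I (fun _ ↦ g) x 0 with hGdef
  set c : E → ℝ := fun z ↦ φ ((extChartAt I x).symm z) with hcdef
  have hGm : MetricCoord.IsMetricOn G (extChartAt I x).target := isMetricOn_chartRep_const g x
  have hG' : chartRep I (fun _ ↦ g') x 0 = fun z ↦ c z • G z := chartRep_const_conformal g g' hgg' x
  have hc : ContDiffOn ℝ ∞ c (extChartAt I x).target := by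
    have h1 : ContMDiffOn 𝓘(ℝ, E) 𝓘(ℝ) ∞ (φ ∘ (extChartAt I x).symm) (extChartAt I x).target :=
      hφ.comp_contMDiffOn (contMDiffOn_extChartAt_symm x)
    exact contMDiffOn_iff_contDiffOn.1 h1
  have hc0 : ∀ z ∈ (extChartAt I x).target, c z ≠ 0 := fun z _ ↦ (hpos _).ne'
  -- the differential of the inverse chart
  set L := mfderiv 𝓘(ℝ, E) I (chartInv I x) y with hL
  have hLi : L.IsInvertible := isInvertible_mfderiv_of_injective rfl (injective_mfderiv_chartInv x y)
  -- the form `B`, transported to `T_{Φ y} M`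
  set Bf : E → E → ℝ := fun u v ↦ MetricCoord.confHess G c y u v
    - MetricCoord.confForm c y u * MetricCoord.confForm c y v
    + 1 / 2 * MetricCoord.confForm c y (MetricCoord.confVec G c y) * G y u v with hBf
  refine ⟨fun U V ↦ Bf (L.inverse U) (L.inverse V), fun X Y Z W ↦ ?_⟩
  obtain ⟨v, rfl⟩ : ∃ v, L v = X := ⟨L.inverse X, hLi.self_apply_inverse X⟩
  obtain ⟨w, rfl⟩ : ∃ w, L w = Y := ⟨L.inverse Y, hLi.self_apply_inverse Y⟩
  obtain ⟨z, rfl⟩ : ∃ z, L z = Z := ⟨L.inverse Z, hLi.self_apply_inverse Z⟩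
  obtain ⟨w', rfl⟩ : ∃ w', L w' = W := ⟨L.inverse W, hLi.self_apply_inverse W⟩
  simp only [hLi.inverse_apply_self]
  -- both curvature forms read in the chart
  have h1 := chartRep_riemAt_eq_curvatureForm hLC' x y v w z w'
  have h2 := chartRep_riemAt_eq_curvatureForm hLC x y v w z w'
  rw [← hL] at h1 h2
  rw [← h1, ← h2, hG']
  have hval : ∀ a b : E, G y a b = g.val (chartInv I x y) (L a) (L b) := fun a b ↦ by
    rw [hGdef, chartRep_apply, val_chartPullback_apply]
  simp only [_root_.smul_apply, smul_eq_mul, hGm.apply_riemAt_conformal hc hc0 y.2, ← hval]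
  have hcy : c y = φ (chartInv I x y) := rfl
  rw [hcy, hBf]

end ConformalCurvature

/-! ### Conformal covariance of the Weyl tensor and invariance of the Weyl energy in dimension four -/

section ConformalWeyl

open Literature.Geometry.Lorentzian (PseudoRiemannianMetric riemannianMeasure)
open Literature.Geometry.Lorentzian.PseudoRiemannianMetric
open Literature.Geometry.Lorentzian

/-- **The Weyl part of `h ⊙ δ` vanishes** (dimension `4`): contracting the Kulkarni–Nomizu
product of any frame `2`-tensor `h` with the Kronecker symbol gives `Rc = (tr h) δ + 2h`,
`Sc = 6 tr h`, and the Weyl combination `K − ½ Rc ⊙̃ δ + (Sc/6)(δδ)` of `weylFrame_fin_four` is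
identically zero — the algebraic reason for the conformal invariance of the Weyl tensor
(Besse 1987, 1.116–1.117: `h ⊙ g` lies in the Ricci/scalar part of the curvature
decomposition). First the contraction: `Σ_m (h ⊙ δ)_{mabm} = (tr h) δ_{ab} + 2 h_{ab}`. [cite: Besse1987, 1.116] -/
theorem sum_kulkarniNomizu_frameDelta_contract (h : Fin 4 → Fin 4 → ℝ) (a b : Fin 4) :
    ∑ m, kulkarniNomizu h frameDelta m a b m = (∑ m, h m m) * frameDelta a b + 2 * h a b := by
  fin_cases a <;> fin_cases b <;>
  simp [Fin.sum_univ_four, kulkarniNomizu, frameDelta] <;> ring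

/-- **The Weyl combination of `h ⊙ δ` vanishes identically** in dimension `4`.
[cite: Besse1987, 1.116–1.117] -/
theorem weylCombination_kulkarniNomizu_frameDelta (h : Fin 4 → Fin 4 → ℝ) (i j k l : Fin 4) :
    kulkarniNomizu h frameDelta i j k l -
        1 / 2 *
          ((∑ m, kulkarniNomizu h frameDelta m i l m) * (if j = k then 1 else 0) +
            (∑ m, kulkarniNomizu h frameDelta m j k m) * (if i = l then 1 else 0) -
            (∑ m, kulkarniNomizu h frameDelta m i k m) * (if j = l then 1 else 0) -
            (∑ m, kulkarniNomizu h frameDelta m j l m) * (if i = k then 1 else 0)) +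
        (∑ a, ∑ m, kulkarniNomizu h frameDelta m a a m) / 6 *
          ((if i = l then 1 else 0) * (if j = k then 1 else 0) -
            (if i = k then 1 else 0) * (if j = l then 1 else 0)) = 0 := by
  simp_rw [sum_kulkarniNomizu_frameDelta_contract]
  simp only [Fin.sum_univ_four, frameDelta_self, mul_one]
  simp only [kulkarniNomizu, frameDelta]
  ring

variable {E : Type*} [NormedAddCommGroup E] [NormedSpace ℝ E] [FiniteDimensional ℝ E]
  [CompleteSpace E] {H : Type*} [TopologicalSpace H] {I : ModelWithCorners ℝ E H} [I.Boundaryless]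
  {M : Type*} [TopologicalSpace M] [ChartedSpace H M] [IsManifold I ∞ M]
  (g g' : PseudoRiemannianMetric I ∞ E (TangentSpace I : M → Type _))
  [g.HasLeviCivita] [g'.HasLeviCivita]

omit [FiniteDimensional ℝ E] [CompleteSpace E] [I.Boundaryless] [g.HasLeviCivita]
  [g'.HasLeviCivita] in
/-- A `g_x`-orthonormal frame rescaled by `ψ(x)⁻¹` is `g'_x`-orthonormal for `g' = ψ² g`.
[folklore] -/
theorem _root_.Literature.Geometry.Lorentzian.PseudoRiemannianMetric.IsOrthonormalFrame.conformal_sq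
    {x : M} {ι : Type*} {e : ι → TangentSpace I x} (he : g.IsOrthonormalFrame x e) {a : ℝ}
    (ha : a ≠ 0) (hgg' : ∀ v w : TangentSpace I x, g'.val x v w = a ^ 2 * g.val x v w) :
    g'.IsOrthonormalFrame x (fun i ↦ a⁻¹ • e i) := by
  refine ⟨fun i ↦ ?_, fun i j hij ↦ ?_⟩
  · rw [hgg']
    simp only [map_smul, _root_.smul_apply, smul_eq_mul, he.1 i]
    field_simp
  · rw [hgg']
    simp only [map_smul, _root_.smul_apply, smul_eq_mul, he.2 i j hij, mul_zero]

/-- **Conformal covariance of the Weyl tensor in dimension four**: for `g' = ψ² g` (`ψ > 0`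
smooth) and a `g_x`-orthonormal `4`-frame `e`, the frame `e/ψ(x)` is `g'_x`-orthonormal and
`W_{g'}(e/ψ)_{ijkl} = ψ(x)⁻² W_g(e)_{ijkl}` — i.e. `W' = ψ² W` as `(0,4)`-tensors,
`W' = W` as `(1,3)`-tensors (Besse 1987, Thm. 1.159 (c); Chang–Gursky–Yang 2003, p. 111: "the
conformal invariance of the Weyl tensor"). From `curvatureForm_conformal` (`Rm' = ψ²(Rm − B ⊙ g)`),
the frame contractions `Ric(e_a,e_b) = Σ Rm(eᵢ,e_a,e_b,eᵢ)`, `S = Σ Ric(eᵢ,eᵢ)` for both metrics,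
and `weylCombination_kulkarniNomizu_frameDelta`. [cite: Besse1987, Thm. 1.159 (c)] -/
theorem _root_.Literature.Geometry.Lorentzian.PseudoRiemannianMetric.weylFrame_conformal_sq
    (hE : finrank ℝ E = 4) {ψ : M → ℝ} (hψ : ContMDiff I 𝓘(ℝ) ∞ ψ) (hpos : ∀ x, 0 < ψ x)
    (hgg' : ∀ (x : M) (v w : TangentSpace I x), g'.val x v w = ψ x ^ 2 * g.val x v w)
    {x : M} {e : Fin 4 → TangentSpace I x} (he : g.IsOrthonormalFrame x e) (i j k l : Fin 4) :
    g'.weylFrame x (fun a ↦ (ψ x)⁻¹ • e a) i j k l = (ψ x)⁻¹ ^ 2 * g.weylFrame x e i j k l := by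
  obtain ⟨B, hB⟩ := g.curvatureForm_conformal g' (φ := fun y ↦ ψ y ^ 2) (hψ.pow 2)
    (fun y ↦ pow_pos (hpos y) 2) hgg' x
  have hψ0 : ψ x ≠ 0 := (hpos x).ne'
  set t : ℝ := (ψ x)⁻¹ with ht
  have htψ : t * ψ x = 1 := inv_mul_cancel₀ hψ0
  -- the rescaled frame is `g'`-orthonormal
  have he' : g'.IsOrthonormalFrame x (fun a ↦ t • e a) := he.conformal_sq g g' hψ0 (hgg' x)
  -- scaling of `Rm'` on the rescaled frame
  have hscale : ∀ m a b n, g'.curvatureForm g'.leviCivita x (t • e m) (t • e a) (t • e b) (t • e n) =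
      t ^ 4 * g'.curvatureForm g'.leviCivita x (e m) (e a) (e b) (e n) := by
    intro m a b n
    simp only [curvatureForm, map_smul, _root_.smul_apply, smul_eq_mul]
    ring
  -- the conformal formula on the frame `e`
  have hconf : ∀ m a b n, g'.curvatureForm g'.leviCivita x (e m) (e a) (e b) (e n) =
      ψ x ^ 2 * (g.curvatureForm g.leviCivita x (e m) (e a) (e b) (e n)
        - kulkarniNomizu (fun a b ↦ B (e a) (e b)) frameDelta m a b n) := by
    intro m a b n
    rw [hB]
    simp only [kulkarniNomizu, he.val_eq_ite, frameDelta]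
  -- together: `Rm'` on the rescaled frame through `Rm` and `B ⊙ δ` on `e`
  have hboth : ∀ m a b n, g'.curvatureForm g'.leviCivita x (t • e m) (t • e a) (t • e b) (t • e n) =
      t ^ 2 * (g.curvatureForm g.leviCivita x (e m) (e a) (e b) (e n)
        - kulkarniNomizu (fun a b ↦ B (e a) (e b)) frameDelta m a b n) := by
    intro m a b n
    have ht4 : t ^ 4 * ψ x ^ 2 = t ^ 2 := by
      rw [show t ^ 4 * ψ x ^ 2 = t ^ 2 * (t * ψ x) ^ 2 by ring, htψ, one_pow, mul_one]
    rw [hscale, hconf, ← mul_assoc, ht4]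
  -- Ricci and scalar curvature of both metrics through the frames
  rw [weylFrame_fin_four, weylFrame_fin_four,
    ← he'.sum_curvatureForm_eq_ricci g' hE, ← he'.sum_curvatureForm_eq_ricci g' hE,
    ← he'.sum_curvatureForm_eq_ricci g' hE, ← he'.sum_curvatureForm_eq_ricci g' hE,
    ← he'.sum_ricci_eq_scalarCurvature g' hE,
    ← he.sum_curvatureForm_eq_ricci g hE, ← he.sum_curvatureForm_eq_ricci g hE,
    ← he.sum_curvatureForm_eq_ricci g hE, ← he.sum_curvatureForm_eq_ricci g hE,
    ← he.sum_ricci_eq_scalarCurvature g hE]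
  simp_rw [← he'.sum_curvatureForm_eq_ricci g' hE, ← he.sum_curvatureForm_eq_ricci g hE, hboth]
  have hW := weylCombination_kulkarniNomizu_frameDelta (fun a b ↦ B (e a) (e b)) i j k l
  simp only [mul_sub, Finset.sum_sub_distrib, ← Finset.mul_sum]
  linear_combination (-(t ^ 2)) * hW


end ConformalWeyl

/-! ### "The `η`-term scales in exactly the same way": `|η|²_{ψ²g} = ψ⁻⁴ |η|²_g` -/

section EtaScaling

open Literature.Geometry.Lorentzian (PseudoRiemannianMetric)
open Literature.Geometry.Lorentzian.PseudoRiemannianMetric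
open Literature.Geometry.Lorentzian

variable {E : Type*} [NormedAddCommGroup E] [NormedSpace ℝ E] [FiniteDimensional ℝ E]
  {H : Type*} [TopologicalSpace H] {I : ModelWithCorners ℝ E H}
  {M : Type*} [TopologicalSpace M] [ChartedSpace H M] [IsManifold I ∞ M] {n : ℕ∞ω}

/-- **The squared norm of a fixed symmetric `2`-tensor scales like `|W|²` under a conformal
change** (Chang–Gursky–Yang 2003, §1, p. 116: "the key point is that this term has the same sign
as the term involving `η` and scales in exactly the same way. That is, if `g = e^{2w} g₀` is a
conformal metric, then `|W_g|²_g = e^{−4w}|W₀|²₀`, `|η|²_g = e^{−4w}|η|²₀`"): if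
`g'_x = a² g_x` with `a ≠ 0` and `g_x` positive definite, then for every bilinear form `T` on
`T_x M`, `|T|²_{g'} = a⁻⁴ |T|²_g` (`normSq` of `MetricNormSq.lean`; with `a² = e^{2w}`,
`a⁻⁴ = e^{−4w}`). Proof: a `g_x`-orthonormal basis `e` gives the `g'_x`-orthonormal basis `e/a`
(as in `IsOrthonormalFrame.conformal_sq`), and `Σ T(e_j/a, e_i/a)² = a⁻⁴ Σ T(e_j, e_i)²`
(`normSq_eq_sum_sq`). The companion law for `|W|²` is `weylNormSq_conformal_sq`
(`Lorentzian/WeylConformal.lean`). [cite: ChangGurskyYang2003, §1, p. 116] -/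
theorem _root_.Literature.Geometry.Lorentzian.PseudoRiemannianMetric.normSq_conformal_sq
    (g g' : PseudoRiemannianMetric I n E (TangentSpace I : M → Type _)) {x : M}
    (hpos : ∀ v : TangentSpace I x, v ≠ 0 → 0 < g.val x v v) {a : ℝ} (ha : a ≠ 0)
    (hgg' : ∀ v w : TangentSpace I x, g'.val x v w = a ^ 2 * g.val x v w)
    (T : LinearMap.BilinForm ℝ (TangentSpace I x)) :
    g'.normSq x T = (a ^ 4)⁻¹ * g.normSq x T := by
  classical
  obtain ⟨b, hb⟩ := g.exists_basis_isOrthonormalFrame (x := x) hpos rfl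
  have hι : Fintype.card (Fin (finrank ℝ E)) = finrank ℝ E := Fintype.card_fin _
  have hb' : g'.IsOrthonormalFrame x (fun i ↦ a⁻¹ • b i) := by
    refine ⟨fun i ↦ ?_, fun i j hij ↦ ?_⟩
    · rw [hgg']
      simp only [map_smul, _root_.smul_apply, smul_eq_mul, hb.1 i]
      field_simp
    · rw [hgg']
      simp only [map_smul, _root_.smul_apply, smul_eq_mul, hb.2 i j hij, mul_zero]
  -- `|T|²_g` and `|T|²_{g'}` as sums of squares on `b` and on `b/a`
  have hO : (g.toBilinForm x).IsOrthoᵢ (hb.toBasis hι) := by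
    intro i j hij
    rw [hb.coe_toBasis hι]
    exact hb.2 i j hij
  have hc : ∀ i, g.val x (hb.toBasis hι i) (hb.toBasis hι i) ≠ 0 := fun i ↦ by
    rw [hb.coe_toBasis hι, hb.1 i]
    exact one_ne_zero
  have hO' : (g'.toBilinForm x).IsOrthoᵢ (hb'.toBasis hι) := by
    intro i j hij
    rw [hb'.coe_toBasis hι]
    exact hb'.2 i j hij
  have hc' : ∀ i, g'.val x (hb'.toBasis hι i) (hb'.toBasis hι i) ≠ 0 := fun i ↦ by
    rw [hb'.coe_toBasis hι, hb'.1 i]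
    exact one_ne_zero
  rw [g.normSq_eq_sum_sq x (hb.toBasis hι) hO hc T, g'.normSq_eq_sum_sq x (hb'.toBasis hι) hO' hc' T]
  simp only [hb.coe_toBasis hι, hb'.coe_toBasis hι, hb.1, hb'.1, mul_one, div_one]
  simp only [map_smul, LinearMap.smul_apply, smul_eq_mul, Finset.mul_sum]
  refine Finset.sum_congr rfl fun i _ ↦ Finset.sum_congr rfl fun j _ ↦ ?_
  field_simp

end EtaScaling


end Literature.Geometry.Riemannian

end
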